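import Literature.NumberTheory.LFunctions.NoRealZeroEvenSmallModuliVI
import Literature.NumberTheory.LFunctions.NoRealZeroOddSmallModuliVI
import HarnessLib

/-!
# The kernel base of the no-real-zero column, both parities: `NoRealZeroUpTo 436`, unconditionally

Topic `Literature/NumberTheory/LFunctions`; namespace `Literature.NumberTheory.LFunctions`. THEOREMS only.
Joins the even kernel base `436` (`noRealZeroEvenUpTo_436`, `NoRealZeroEvenSmallModuliVI.lean`; wall
`437 = 19·23`) and the odd kernel base `436` (`noRealZeroOddUpTo_436`, `NoRealZeroOddSmallModuliVI.lean`: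
order-two Fekete–Pólya certificates along induced characters, and Low's grouping of Epstein zeta
functions — `232, 235, 267, 340, 372, 379, 388, 408, 427` by the pair criterion, `403` by the mixed
criterion with a round partner class): **`noRealZeroUpTo_436 : NoRealZeroUpTo 436`** — for every
modulus `3 ≤ q ≤ 436`, every primitive quadratic Dirichlet character `χ` mod `q` and every `σ ∈ (0, 1)`,
`L(σ, χ) ≠ 0` — with no named fact (previous both-parity bases: `231`, `266`, `402`). The two halves
of the wide column now have the SAME kernel base; the next wall is the even character `χ₄₃₇`
(real quadratic field `ℚ(√437)`, no Fekete–Pólya witness of order `≤ 24` and modulus `≤ 3·10⁶`).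

## References

* M. E. Low, *Real zeros of the Dedekind zeta function of an imaginary quadratic field*, Acta Arith. 14
  (1968) 117–140. [Low1968]
* H. L. Montgomery, R. C. Vaughan, *Multiplicative Number Theory I*, CUP 2007, §11.2.1 Exercises 7–8.
  [MontgomeryVaughan2007]
-/

namespace Literature.NumberTheory.LFunctions

/-- **`NoRealZeroUpTo 436`, both parities, unconditionally** (odd base `436`, even base `436`).
[cite: Low1968, Theorem 5 (via MR 38#4425)] [cite: MontgomeryVaughan2007, §11.2.1 Exercises 7 (g), 8] -/
theorem noRealZeroUpTo_436 : NoRealZeroUpTo 436 :=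
  NoRealZeroUpTo.iff_odd_and_even.mpr ⟨noRealZeroOddUpTo_436, noRealZeroEvenUpTo_436⟩

/-- `NoExceptionalZeroUpTo 436 c` for every `c`. [cite: Low1968, Theorem 5 (via MR 38#4425)] -/
theorem noExceptionalZeroUpTo_436 (c : ℝ) : NoExceptionalZeroUpTo 436 c :=
  noRealZeroUpTo_436.noExceptionalZeroUpTo c

/-- The kernel bases of the wide column after this file: both parities, odd and even all at `436`.
[cite: Low1968, Theorem 5 (via MR 38#4425)] -/
theorem noRealZero_kernelBase_436 : NoRealZeroUpTo 436 ∧ NoRealZeroOddUpTo 436 ∧ NoRealZeroEvenUpTo 436 :=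
  ⟨noRealZeroUpTo_436, noRealZeroOddUpTo_436, noRealZeroEvenUpTo_436⟩

end Literature.NumberTheory.LFunctions
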